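import Summits.CriticalPhenomena.PercolationContinuityZ3.Theorems.Transplant.SkelPhiParaRunFrame
import Summits.CriticalPhenomena.PercolationContinuityZ3.Theorems.Transplant.SkelPhiSeedSlab
import Summits.CriticalPhenomena.PercolationContinuityZ3.Theorems.Transplant.SkelPhiQStepsN
import HarnessLib

/-!
# N1 (the `{±1}` node), LEVEL 1, kit adapter file N-K1″: THE RUN FRAMES HAVE QUASI-STEPS OF COST `k + 3` UNDER THE SLOPE BOUND `|h| ≤ k·n` —
# `QStepsN G (runX φ c₀ n h σ) (k + 3)` and the same for `runY` (`Steps G φ`, `1 ≤ n`, `σ = ±1`), with the EXACT inner footprint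

builds on p205010 (kernel theorem, internal audit signed; external expert review pending) — nothing in this file uses p205010; nothing here is a
claim about the open node `SamePDropOfSkeletonNeg`.
Lane `prim-bschramm`, seat `prim-bschramm-p1` (gen 11); helper file (`--supports stmt-CriticalPhenomena-4575 --as helper`).
WHY.  The κ-ruling (design owner 2026-08-21 13:56:36Z, lead 13:56:39Z): LEVEL 0 delivers the long data with `|h_L| ≤ k·n_L` (k = 10), and the run
windows keep the α-raw frames `runX = (σα, ⌊σβ′/U⌋)`, `runY` (coordinates exchanged), `U = n + |h|`, `β′ = nβ − hα`.  Their unit moves, with every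
INNER vertex of the walk at the frame value of the start (hp-8 (b)): INWARD (level `± 1`, `α` fixed) — `m ≤ k + 2` φ-steps along `e_β` (each moves
`σβ′` by `n ≤ U`; the first `m − 1` keep the level, the `m`-th moves it by exactly `± 1`); TANGENTIAL (`σα ± 1`, level fixed) — first `j ≤ k + 1`
PRE-CORRECTING `e_β`-steps at fixed frame value (the residues `r′ ≡ r (mod n)` with `r′ ∓ h ∈ [0, U)` form a half-open interval of length `≥ n`, and the
`±n`-walk from `r` to such an `r′` stays in `[0, U)`), then ONE `e_α`-step landing exactly.
* §1 arithmetic: `exists_mul_add_mem_Ico` (a residue class meets an interval of length `n`), `exists_precorrection`, `exists_first_exit_up/down`;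
* §2 chains of `φ`-steps as walks: `exists_walk_of_chain`; the `e_β`-column through `Skelφ.walk`: `runX_walk_zero`, `sshear_walk` (σβ′ along the column);
* §3 **`runX_tangential`**, **`runX_inward`**, **`qStepsN_runX`**, **`qStepsN_runY`**.
[cite: MartineauTassion2017, §3 (the sheared coordinates (x, y′)), §4.3] [cite: KozmaNitzan2024, §4 p. 26 ((29): columns)]
-/

noncomputable section

open scoped Classical

namespace Summit.CriticalPhenomena.PercolationContinuityZ3.Theorems.Transplant

namespace Skelφ

open Literature.Probability.Percolation Literature.Probability.LatticeModels SimpleGraph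
open Literature.Barriers.CriticalPhenomena (graphBall graphBall_mono mem_graphBall_self)

variable {V : Type} {G : SimpleGraph V} {φ : V → Site 2}

/-! ## §1 Arithmetic of residues -/

/-- **A residue class mod `n` meets every half-open interval of length `≥ n`**: for `0 < n` and `L + n ≤ M` there is `j : ℤ` with
`L ≤ r + n j < M`. [folklore] -/
theorem exists_mul_add_mem_Ico {n : ℤ} (hn : 0 < n) (r L M : ℤ) (hLM : L + n ≤ M) : ∃ j : ℤ, L ≤ r + n * j ∧ r + n * j < M := by
  -- `j := ⌈(L − r)/n⌉` realised as `-((r - L) / n)` (floor division)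
  refine ⟨-((r - L) / n), ?_, ?_⟩
  · have h1 := Int.ediv_mul_le (r - L) hn.ne'
    have : n * ((r - L) / n) ≤ r - L := by rw [mul_comm]; exact h1
    linarith
  · have h2 := Int.lt_ediv_add_one_mul_self (r - L) hn
    have : r - L < n * ((r - L) / n) + n := by linarith [mul_comm ((r - L) / n + 1) n]
    linarith

/-- **Pre-correction**: for a residue `r ∈ [0, U)`, a step `e` with `|e| + n ≤ U` and `0 < n`, some `r′ = r + n j` has `r′ ∈ [0, U)`, `r′ + e ∈ [0, U)`
and `|n j| < U`. [this work] -/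
theorem exists_precorrection {n U r e : ℤ} (hn : 0 < n) (hr0 : 0 ≤ r) (hrU : r < U) (he : |e| + n ≤ U) :
    ∃ j : ℤ, 0 ≤ r + n * j ∧ r + n * j < U ∧ 0 ≤ r + n * j + e ∧ r + n * j + e < U ∧ |n * j| < U := by
  obtain ⟨j, h1, h2⟩ := exists_mul_add_mem_Ico hn r (max 0 (-e)) (min U (U - e)) (by
    rcases le_or_gt 0 e with he0 | he0
    · rw [abs_of_nonneg he0] at he
      rw [max_eq_left (by linarith), min_eq_right (by linarith)]; linarith
    · rw [abs_of_neg he0] at he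
      rw [max_eq_right (by linarith), min_eq_left (by linarith)]; linarith)
  refine ⟨j, le_trans (le_max_left _ _) h1, lt_of_lt_of_le h2 (min_le_left _ _), ?_, ?_, ?_⟩
  · have := le_trans (le_max_right _ _) h1; linarith
  · have := lt_of_lt_of_le h2 (min_le_right _ _); linarith
  · have ha : 0 ≤ r + n * j := le_trans (le_max_left _ _) h1
    have hb : r + n * j < U := lt_of_lt_of_le h2 (min_le_left _ _)
    rw [abs_lt]; constructor <;> linarith

/-- **First exit upwards**: for `r ∈ [0, U)` and `0 < n ≤ U` there is `m ≥ 1`, `n·m ≤ U + n`, with `r + n j < U` for `j < m` and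
`U ≤ r + n m < 2U`. [this work] -/
theorem exists_first_exit_up {n U r : ℤ} (hn : 0 < n) (hnU : n ≤ U) (hr0 : 0 ≤ r) (hrU : r < U) :
    ∃ m : ℕ, 1 ≤ m ∧ (n : ℤ) * m ≤ U + n ∧ (∀ j : ℕ, j < m → r + n * j < U) ∧ U ≤ r + n * m ∧ r + n * m < 2 * U := by
  -- `m` = the least natural with `r + n m ≥ U`
  have hex : ∃ m : ℕ, U ≤ r + n * m := by
    refine ⟨U.toNat, ?_⟩
    have hU : (0 : ℤ) ≤ U := by linarith
    have : (U.toNat : ℤ) = U := Int.toNat_of_nonneg hU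
    rw [this]; nlinarith
  refine ⟨Nat.find hex, ?_, ?_, fun j hj => ?_, Nat.find_spec hex, ?_⟩
  · by_contra h0
    have h00 : Nat.find hex = 0 := by omega
    have := Nat.find_spec hex
    rw [h00] at this; push_cast at this; linarith
  · -- `r + n (m − 1) < U`
    have hm1 : 1 ≤ Nat.find hex := by
      by_contra h0
      have h00 : Nat.find hex = 0 := by omega
      have := Nat.find_spec hex
      rw [h00] at this; push_cast at this; linarith
    have hlt := Nat.find_min hex (show Nat.find hex - 1 < Nat.find hex by omega)
    push Not at hlt
    have e1 : ((Nat.find hex - 1 : ℕ) : ℤ) = (Nat.find hex : ℤ) - 1 := by rw [Nat.cast_sub hm1]; simp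
    rw [e1] at hlt
    nlinarith
  · have := Nat.find_min hex hj
    push Not at this; exact this
  · have hm1 : 1 ≤ Nat.find hex := by
      by_contra h0
      have h00 : Nat.find hex = 0 := by omega
      have := Nat.find_spec hex
      rw [h00] at this; push_cast at this; linarith
    have hlt := Nat.find_min hex (show Nat.find hex - 1 < Nat.find hex by omega)
    push Not at hlt
    have e1 : ((Nat.find hex - 1 : ℕ) : ℤ) = (Nat.find hex : ℤ) - 1 := by rw [Nat.cast_sub hm1]; simp
    rw [e1] at hlt
    nlinarith

/-- **First exit downwards**: for `r ∈ [0, U)` and `0 < n ≤ U` there is `m ≥ 1`, `n·m ≤ U + n`, with `0 ≤ r − n j` for `j < m` and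
`−U ≤ r − n m < 0`. [this work] -/
theorem exists_first_exit_down {n U r : ℤ} (hn : 0 < n) (hnU : n ≤ U) (hr0 : 0 ≤ r) (hrU : r < U) :
    ∃ m : ℕ, 1 ≤ m ∧ (n : ℤ) * m ≤ U + n ∧ (∀ j : ℕ, j < m → 0 ≤ r - n * j) ∧ r - n * m < 0 ∧ -U ≤ r - n * m := by
  -- reflect: `r′ := U − 1 − r`
  obtain ⟨m, hm1, hmU, hbefore, hge, hlt⟩ := exists_first_exit_up hn hnU (show 0 ≤ U - 1 - r by linarith) (show U - 1 - r < U by linarith)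
  exact ⟨m, hm1, hmU, fun j hj => by have := hbefore j hj; linarith, by linarith, by linarith⟩

/-! ## §2 Chains of φ-steps as walks; the `e_β`-column in the run frame -/

/-- A chain `f 0 ∼ f 1 ∼ ⋯` gives a walk of length `m` from `f 0` to `f m` whose support consists of the `f i`, `i ≤ m`. [folklore] -/
theorem exists_walk_of_chain (f : ℕ → V) (hf : ∀ i, G.Adj (f i) (f (i + 1))) (m : ℕ) :
    ∃ p : G.Walk (f 0) (f m), p.length = m ∧ ∀ u ∈ p.support, ∃ i, i ≤ m ∧ u = f i := by
  induction m with
  | zero => exact ⟨Walk.nil, rfl, fun u hu => ⟨0, le_rfl, by simpa using hu⟩⟩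
  | succ m ih =>
    obtain ⟨p, hp, hs⟩ := ih
    refine ⟨p.concat (hf m), by rw [Walk.length_concat, hp], fun u hu => ?_⟩
    rw [Walk.support_concat, List.mem_append, List.mem_singleton] at hu
    rcases hu with hu | rfl
    · obtain ⟨i, hi, rfl⟩ := hs u hu; exact ⟨i, by omega, rfl⟩
    · exact ⟨m + 1, le_rfl, rfl⟩

/-- Along an `e_β`-column the raw run coordinate is constant. [folklore] -/
theorem runX_walk_zero (hstep : Steps G φ) (c₀ : V) (n : ℕ) (h σ : ℤ) (τ : ℤˣ) (w : V) (i : ℕ) :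
    runX φ c₀ n h σ (walk G φ 1 τ w i) 0 = runX φ c₀ n h σ w 0 := by
  rw [runX_zero, runX_zero, relCoord_apply, relCoord_apply, φ_walk hstep]; simp

/-- Along an `e_β`-column `σβ′` moves by `σ τ n` per step. [folklore] -/
theorem sshear_walk (hstep : Steps G φ) (c₀ : V) (n : ℕ) (h σ : ℤ) (τ : ℤˣ) (w : V) (i : ℕ) :
    σ * shearCoord φ c₀ n h (walk G φ 1 τ w i) = σ * shearCoord φ c₀ n h w + σ * (τ : ℤ) * n * i := by
  rw [shearCoord_apply, shearCoord_apply, φ_walk hstep]; simp; ring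

/-- After an `e_α`-step of sign `τ` the raw run coordinate moves by `σ τ` and `σβ′` by `−σ h τ`. [folklore] -/
theorem runX_of_step_zero (c₀ : V) (n : ℕ) (h σ : ℤ) {w w' : V} {τ : ℤ} (hw' : φ w' = φ w + Pi.single 0 τ) :
    runX φ c₀ n h σ w' 0 = runX φ c₀ n h σ w 0 + σ * τ ∧ σ * shearCoord φ c₀ n h w' = σ * shearCoord φ c₀ n h w - σ * h * τ := by
  rw [runX_zero, runX_zero, relCoord_apply, relCoord_apply, shearCoord_apply, shearCoord_apply, hw']; simp; constructor <;> ring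

/-- The level coordinate from the residue: `σβ′ = U q + r′`, `r′ ∈ [0, U)` gives level `q`. [folklore] -/
theorem runX_one_eq_of_residue {n : ℕ} (hn : 1 ≤ n) (c₀ : V) (h σ : ℤ) (w : V) {q r' : ℤ}
    (hw : σ * shearCoord φ c₀ n h w = (shearUnit n h : ℤ) * q + r') (h0 : 0 ≤ r') (h1 : r' < shearUnit n h) : runX φ c₀ n h σ w 1 = q := by
  rw [runX_one, hw]
  exact TwoAxis.Para.ediv_eq_of_bounds (shearUnit_pos hn h) (by linarith) (by linarith)

/-! ## §3 The quasi-steps of the run frames -/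

section Moves

variable (hstep : Steps G φ) {n : ℕ} (hn : 1 ≤ n) (c₀ : V) (h : ℤ) {σ : ℤ} (hσ : σ = 1 ∨ σ = -1) {k : ℕ} (hκ : h.natAbs ≤ k * n)
include hstep hn hσ hκ

/-- **TANGENTIAL QUASI-STEP OF THE x-RUN FRAME**: `σα` moves by `τ = ±1` at fixed level through a walk of length `≤ k + 2` whose inner vertices are
at the frame value of the start (pre-correcting `e_β`-column, then one `e_α`-step). [this work] -/
theorem runX_tangential (w : V) (τ : ℤˣ) :
    ∃ w', runX φ c₀ n h σ w' = runX φ c₀ n h σ w + Pi.single 0 (τ : ℤ) ∧ LinkN G (runX φ c₀ n h σ) (k + 3) w w' := by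
  have hn0 : (0 : ℤ) < n := by exact_mod_cast hn
  have hU := shearUnit_pos hn h
  have hσσ : σ * σ = 1 := by rcases hσ with rfl | rfl <;> simp
  obtain ⟨σu, hσu⟩ : ∃ u : ℤˣ, (u : ℤ) = σ := by
    rcases hσ with rfl | rfl
    · exact ⟨1, rfl⟩
    · exact ⟨-1, rfl⟩
  set ψ := runX φ c₀ n h σ with hψ
  set U : ℤ := (shearUnit n h : ℤ) with hUdef
  have hUeq : U = n + h.natAbs := by rw [hUdef]; unfold shearUnit; push_cast; rfl
  -- the residue of `w`
  set s := σ * shearCoord φ c₀ n h w with hs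
  set q := ψ w 1 with hq
  set r := s - U * q with hr
  have hqdef : q = s / U := by rw [hq, hψ, runX_one]
  have hr0 : 0 ≤ r := by rw [hr, hqdef]; have := Int.emod_nonneg s hU.ne'; rw [Int.emod_def] at this; linarith
  have hrU : r < U := by rw [hr, hqdef]; have := Int.emod_lt_of_pos s hU; rw [Int.emod_def] at this; linarith
  -- the α-step shifts `σβ′` by `e = −σ h (σ τ) = −h τ`
  set e : ℤ := -(h * (τ : ℤ)) with he
  have hτ1 : |(τ : ℤ)| = 1 := by rcases Int.units_eq_one_or τ with h1 | h1 <;> simp [h1]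
  have heU : |e| + n ≤ U := by
    rw [he, abs_neg, abs_mul, hτ1, mul_one, hUeq, ← Int.natCast_natAbs]; linarith
  obtain ⟨j, hj0, hjU, hje0, hjeU, hjabs⟩ := exists_precorrection hn0 hr0 hrU heU
  -- the pre-correcting column: direction `d` with `σ d n = n·sign(j)`, `|j|` steps
  obtain ⟨d, hd⟩ : ∃ d : ℤˣ, σ * (d : ℤ) * n * (j.natAbs : ℤ) = n * j := by
    rcases le_or_gt 0 j with hj | hj
    · refine ⟨σu, ?_⟩; rw [hσu, hσσ, one_mul, Int.natAbs_of_nonneg hj]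
    · refine ⟨-σu, ?_⟩
      rw [Units.val_neg, hσu, mul_neg, hσσ, Int.ofNat_natAbs_of_nonpos hj.le]; ring
  set f : ℕ → V := fun i => walk G φ 1 d w i with hf
  have hf0 : ∀ i, ψ (f i) 0 = ψ w 0 := fun i => runX_walk_zero hstep c₀ n h σ d w i
  have hfs : ∀ i, σ * shearCoord φ c₀ n h (f i) = s + σ * (d : ℤ) * n * i := fun i => sshear_walk hstep c₀ n h σ d w i
  -- every column vertex up to `|j|` keeps the level `q`
  have hlev : ∀ i : ℕ, i ≤ j.natAbs → ψ (f i) 1 = q := by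
    intro i hi
    -- `σβ′(f i) = s + (n j) * (i/|j|)`-ish: between `s` and `s + n j`, both with residue in `[0, U)`
    have hsi := hfs i
    -- `σ d n i` lies between `0` and `n j`
    have hbetween : (0 ≤ σ * (d : ℤ) * n * i ∧ σ * (d : ℤ) * n * i ≤ n * j) ∨ (n * j ≤ σ * (d : ℤ) * n * i ∧ σ * (d : ℤ) * n * i ≤ 0) := by
      have hi' : (i : ℤ) ≤ j.natAbs := by exact_mod_cast hi
      have hdn : σ * (d : ℤ) * n = n ∨ σ * (d : ℤ) * n = -n := by
        rcases hσ with rfl | rfl <;> rcases Int.units_eq_one_or d with h1 | h1 <;> simp [h1]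
      rcases hdn with h1 | h1
      · rw [h1] at hd ⊢
        left; constructor
        · positivity
        · calc (n : ℤ) * i ≤ n * j.natAbs := by gcongr
            _ = n * j := hd
      · rw [h1] at hd ⊢
        have hmul := mul_le_mul_of_nonneg_left hi' hn0.le
        have hpos : (0 : ℤ) ≤ n * i := by positivity
        right; constructor
        · calc (n : ℤ) * j = -↑n * ↑j.natAbs := hd.symm
            _ ≤ -↑n * i := by linarith
        · linarith
    apply runX_one_eq_of_residue hn c₀ h σ (f i) (q := q) (r' := r + σ * (d : ℤ) * n * i)
    · rw [hsi, hr]; ring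
    · rcases hbetween with ⟨h1, h2⟩ | ⟨h1, h2⟩ <;> linarith
    · rcases hbetween with ⟨h1, h2⟩ | ⟨h1, h2⟩ <;> [linarith; linarith]
  -- the α-step from the column's end
  obtain ⟨w', hadj, hφ'⟩ := hstep (f j.natAbs) 0 (τ * σu)
  have hφ'' : φ w' = φ (f j.natAbs) + Pi.single 0 ((τ : ℤ) * σ) := by rw [hφ']; simp [hσu]
  have hstep0 := runX_of_step_zero (φ := φ) c₀ n h σ hφ''
  have hw'0 : ψ w' 0 = ψ w 0 + τ := by
    rw [hψ, hstep0.1, ← hψ, hf0]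
    have : σ * ((τ : ℤ) * σ) = τ * (σ * σ) := by ring
    rw [this, hσσ, mul_one]
  have hw'1 : ψ w' 1 = q := by
    apply runX_one_eq_of_residue hn c₀ h σ w' (q := q) (r' := r + n * j + e)
    · rw [hstep0.2, hfs, hd, hr, he]
      have : σ * h * ((τ : ℤ) * σ) = h * τ * (σ * σ) := by ring
      rw [this, hσσ, mul_one]; ring
    · exact hje0
    · exact hjeU
  refine ⟨w', ?_, ?_⟩
  · funext i; fin_cases i
    · show ψ w' 0 = (ψ w + Pi.single (0 : Fin 2) (τ : ℤ) : Site 2) 0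
      rw [Pi.add_apply, Pi.single_eq_same, hw'0]
    · show ψ w' 1 = (ψ w + Pi.single (0 : Fin 2) (τ : ℤ) : Site 2) 1
      rw [Pi.add_apply, Pi.single_eq_of_ne (by decide), add_zero, hw'1]
  · obtain ⟨p, hp, hsupp⟩ := exists_walk_of_chain (G := G) f (fun i => walk_adj hstep 1 d w i) j.natAbs
    have hf00 : f 0 = w := rfl
    refine ⟨(p.copy hf00 rfl).concat hadj, ?_, fun u hu => ?_⟩
    · rw [Walk.length_concat, Walk.length_copy, hp]
      -- `|j| ≤ k + 1` from `|n j| < U ≤ (k+1) n`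
      have h1 : (j.natAbs : ℤ) * n = |n * j| := by rw [abs_mul, Int.natCast_natAbs, abs_of_pos hn0, mul_comm]
      have h2 : (h.natAbs : ℤ) ≤ k * n := by exact_mod_cast hκ
      have hj' : (j.natAbs : ℤ) * n < ((k : ℤ) + 2) * n := by rw [h1]; linarith
      have hj'' : (j.natAbs : ℤ) < (k : ℤ) + 2 := lt_of_mul_lt_mul_right hj' hn0.le
      omega
    · rw [Walk.support_concat, List.mem_append, List.mem_singleton, Walk.support_copy] at hu
      rcases hu with hu | rfl
      · obtain ⟨i, hi, rfl⟩ := hsupp u hu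
        left
        funext c; fin_cases c
        · exact hf0 i
        · show ψ (f i) 1 = ψ w 1
          rw [hlev i hi]
      · right; rfl

/-- **INWARD QUASI-STEP OF THE x-RUN FRAME**: the level moves by `τ = ±1` at fixed `σα` through an `e_β`-column of length `≤ k + 2` whose first
vertices keep the start level. [this work] -/
theorem runX_inward (w : V) (τ : ℤˣ) :
    ∃ w', runX φ c₀ n h σ w' = runX φ c₀ n h σ w + Pi.single 1 (τ : ℤ) ∧ LinkN G (runX φ c₀ n h σ) (k + 3) w w' := by
  have hn0 : (0 : ℤ) < n := by exact_mod_cast hn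
  have hU := shearUnit_pos hn h
  have hσσ : σ * σ = 1 := by rcases hσ with rfl | rfl <;> simp
  obtain ⟨σu, hσu⟩ : ∃ u : ℤˣ, (u : ℤ) = σ := by
    rcases hσ with rfl | rfl
    · exact ⟨1, rfl⟩
    · exact ⟨-1, rfl⟩
  set ψ := runX φ c₀ n h σ with hψ
  set U : ℤ := (shearUnit n h : ℤ) with hUdef
  have hUeq : U = n + h.natAbs := by rw [hUdef]; unfold shearUnit; push_cast; rfl
  have hnU : (n : ℤ) ≤ U := by rw [hUeq]; exact le_add_of_nonneg_right (by positivity)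
  have hUk : U ≤ (k + 1 : ℕ) * n := by
    have h2 : (h.natAbs : ℤ) ≤ k * n := by exact_mod_cast hκ
    rw [hUeq]; push_cast; linarith
  set s := σ * shearCoord φ c₀ n h w with hs
  set q := ψ w 1 with hq
  set r := s - U * q with hr
  have hqdef : q = s / U := by rw [hq, hψ, runX_one]
  have hr0 : 0 ≤ r := by rw [hr, hqdef]; have := Int.emod_nonneg s hU.ne'; rw [Int.emod_def] at this; linarith
  have hrU : r < U := by rw [hr, hqdef]; have := Int.emod_lt_of_pos s hU; rw [Int.emod_def] at this; linarith
  -- direction `d` with `σ d = τ` (so that `σβ′` moves by `τ n` per step)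
  set d : ℤˣ := τ * σu with hd
  have hσd : σ * (d : ℤ) * n = τ * n := by
    rw [hd, Units.val_mul, hσu]
    have : σ * ((τ : ℤ) * σ) * n = τ * n * (σ * σ) := by ring
    rw [this, hσσ, mul_one]
  set f : ℕ → V := fun i => walk G φ 1 d w i with hf
  have hf0 : ∀ i, ψ (f i) 0 = ψ w 0 := fun i => runX_walk_zero hstep c₀ n h σ d w i
  have hfs : ∀ i : ℕ, σ * shearCoord φ c₀ n h (f i) = s + τ * n * i := fun i => by rw [sshear_walk hstep c₀ n h σ d w i, hσd]
  -- first exit of the residue, by the sign of `τ`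
  have key : ∃ m : ℕ, 1 ≤ m ∧ (n : ℤ) * m ≤ U + n ∧ (∀ i : ℕ, i < m → ψ (f i) 1 = q) ∧ ψ (f m) 1 = q + τ := by
    rcases Int.units_eq_one_or τ with h1 | h1
    · obtain ⟨m, hm1, hmU, hbefore, hge, hlt⟩ := exists_first_exit_up hn0 hnU hr0 hrU
      refine ⟨m, hm1, hmU, fun i hi => ?_, ?_⟩
      · apply runX_one_eq_of_residue hn c₀ h σ (f i) (q := q) (r' := r + n * i)
        · rw [hfs, hr, h1]; push_cast; ring
        · positivity
        · exact hbefore i hi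
      · apply runX_one_eq_of_residue hn c₀ h σ (f m) (q := q + τ) (r' := r + n * m - U)
        · rw [hfs, hr, h1]; push_cast; ring
        · linarith
        · linarith
    · obtain ⟨m, hm1, hmU, hbefore, hlt, hge⟩ := exists_first_exit_down hn0 hnU hr0 hrU
      refine ⟨m, hm1, hmU, fun i hi => ?_, ?_⟩
      · apply runX_one_eq_of_residue hn c₀ h σ (f i) (q := q) (r' := r - n * i)
        · rw [hfs, hr, h1]; push_cast; ring
        · exact hbefore i hi
        · linarith [show (0 : ℤ) ≤ n * i by positivity]
      · apply runX_one_eq_of_residue hn c₀ h σ (f m) (q := q + τ) (r' := r - n * m + U)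
        · rw [hfs, hr, h1]; push_cast; ring
        · linarith
        · linarith
  obtain ⟨m, hm1, hmU, hbefore, hlast⟩ := key
  refine ⟨f m, ?_, ?_⟩
  · funext i; fin_cases i
    · show ψ (f m) 0 = (ψ w + Pi.single (1 : Fin 2) (τ : ℤ) : Site 2) 0
      rw [Pi.add_apply, Pi.single_eq_of_ne (by decide), add_zero, hf0]
    · show ψ (f m) 1 = (ψ w + Pi.single (1 : Fin 2) (τ : ℤ) : Site 2) 1
      rw [Pi.add_apply, Pi.single_eq_same, hlast]
  · obtain ⟨p, hp, hsupp⟩ := exists_walk_of_chain (G := G) f (fun i => walk_adj hstep 1 d w i) m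
    have hf00 : f 0 = w := rfl
    refine ⟨p.copy hf00 rfl, ?_, fun u hu => ?_⟩
    · rw [Walk.length_copy, hp]
      have hm' : (n : ℤ) * m ≤ n * ((k : ℤ) + 2) := by push_cast at hUk; linarith
      have hm'' : (m : ℤ) ≤ (k : ℤ) + 2 := le_of_mul_le_mul_left hm' hn0
      omega
    · rw [Walk.support_copy] at hu
      obtain ⟨i, hi, rfl⟩ := hsupp u hu
      rcases Nat.lt_or_ge i m with hi' | hi'
      · left
        funext c; fin_cases c
        · exact hf0 i
        · show ψ (f i) 1 = ψ w 1
          rw [hbefore i hi']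
      · right; rw [le_antisymm hi hi']

/-- **THE x-RUN FRAME HAS QUASI-STEPS OF COST `k + 3`** under `|h| ≤ k·n` (`Steps G φ`, `1 ≤ n`, `σ = ±1`). [this work] -/
theorem qStepsN_runX : QStepsN G (runX φ c₀ n h σ) (k + 3) := by
  intro w i τ
  fin_cases i
  · exact runX_tangential hstep hn c₀ h hσ hκ w τ
  · exact runX_inward hstep hn c₀ h hσ hκ w τ

/-- **THE y′-RUN FRAME HAS QUASI-STEPS OF COST `k + 3`** (coordinates exchanged). [this work] -/
theorem qStepsN_runY : QStepsN G (runY φ c₀ n h σ) (k + 3) := by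
  intro w i τ
  have hswap : ∀ u : V, runY φ c₀ n h σ u = fun j => runX φ c₀ n h σ u (if j = 0 then 1 else 0) := by
    intro u; funext j; fin_cases j <;> simp [runY, runX]
  obtain ⟨w', hw', p, hp, htr⟩ := qStepsN_runX hstep hn c₀ h hσ hκ w (if i = 0 then 1 else 0) τ
  refine ⟨w', ?_, p, hp, fun u hu => ?_⟩
  · rw [hswap, hswap, hw']
    funext j; fin_cases i <;> fin_cases j <;> simp
  · rcases htr u hu with h1 | h1
    · left; rw [hswap u, hswap w, h1]
    · right; exact h1

end Moves

end Skelφ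

end Summit.CriticalPhenomena.PercolationContinuityZ3.Theorems.Transplant

end
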